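import Summits.RiemannHypothesis.RiemannHypothesis.Theorems.SignConeConeMagnificationLaplace
import Mathlib.NumberTheory.LSeries.Basic
import Mathlib.MeasureTheory.Integral.DominatedConvergence

/-!
# `ConeMagnification`: the Laplace transform of a translated fake prime sum (route `SignCone`, item
stmt-RiemannHypothesis-16303; HELPER file, `--supports`)

Dirichlet-series side of the continuation step. For a weight `c ≥ 0`, a continuous kernel `G` vanishing on
`|v| ≥ R` and the translated fake prime sums
`P(x) = Σₙ c(n) n^{-1/2} (G(log n - x) + G(-log n - x))` (`= P_c(G(· - x))`):

* `continuous_fakeSum_translate` — `P` is continuous (locally a finite sum);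
* `integral_fakeSum_translate_mul_exp` — for `Re z ≥ 0` with `Σ c(n) n^{-1/2-Re z} < ∞`, the Laplace integral
  may be taken termwise: `∫₀^∞ P(x) e^{-zx} dx = Σₙ c(n) n^{-1/2} ∫₀^∞ (G(log n - x) + G(-log n - x)) e^{-zx} dx`
  (`integral_tsum_of_summable_integral_norm` with the majorant of `integral_norm_shift_mul_exp_le`);
* `LSeries_mul_transform_eq` — hence, evaluating the terms with `log n ≥ R` by `laplace_shift_eq`,
  `D_c(z + 1/2) · Gt(z) = ∫₀^∞ P(x) e^{-zx} dx - Fin(z)`, `Gt(z) = ∫ G(v) e^{zv} dv`, where `Fin` is a FINITE sum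
  of Laplace transforms of bounded continuous functions and of `n^{-z} Gt(z)`, holomorphic on `Re z > 0`
  (`differentiableOn_finCorrection`).
-/

noncomputable section

-- `Summit.RiemannHypothesis.RiemannHypothesis.…` repeats a namespace component by design (D-0017 layout).
set_option linter.dupNamespace false

open Complex Filter Set MeasureTheory Metric Topology LSeries

namespace Summit.RiemannHypothesis.RiemannHypothesis.Theorems.SignCone

variable {G : ℝ → ℂ} {R : ℝ} {c : ℕ → ℝ}

/-! ## Support bookkeeping for the shifted kernels -/

/-- If `G` vanishes on `|v| ≥ R`, then `G(log n - x) = 0` and `G(-log n - x) = 0` as soon as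
`log n ≥ R + |x|`. [folklore] -/
theorem shift_eq_zero_of_le_log (hsupp : ∀ v : ℝ, R ≤ |v| → G v = 0) {x : ℝ} {n : ℕ}
    (hn : R + |x| ≤ Real.log n) : G (Real.log n - x) = 0 ∧ G (-Real.log n - x) = 0 := by
  constructor
  · apply hsupp
    calc R ≤ Real.log n - |x| := by linarith
      _ ≤ |Real.log n - x| := by
          have := abs_sub_abs_le_abs_sub (Real.log n) x
          rw [abs_of_nonneg (Real.log_natCast_nonneg n)] at this
          exact this
  · apply hsupp
    rw [show -Real.log n - x = -(Real.log n + x) by ring, abs_neg]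
    calc R ≤ Real.log n - |x| := by linarith
      _ ≤ |Real.log n + x| := by
          have := abs_add_le (Real.log n + x) (-x)
          rw [add_neg_cancel_right, abs_neg, abs_of_nonneg (Real.log_natCast_nonneg n)] at this
          linarith

/-- Beyond `n > e^{R + X}`, every `x` with `|x| ≤ X` has `log n ≥ R + |x|`. [folklore] -/
theorem le_log_of_floor_lt {X x : ℝ} (hx : |x| ≤ X) {n : ℕ} (hn : ⌊Real.exp (R + X)⌋₊ + 1 ≤ n) :
    R + |x| ≤ Real.log n := by
  have hn' : Real.exp (R + X) < n := (Nat.lt_floor_add_one _).trans_le (by exact_mod_cast hn)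
  have hpos : (0 : ℝ) < n := (Real.exp_pos _).trans hn'
  have hlog : R + X < Real.log n := (Real.lt_log_iff_exp_lt hpos).2 hn'
  linarith

/-! ## Continuity of the translated fake prime sum -/

/-- The translated fake prime sum `x ↦ Σₙ c(n) n^{-1/2} (G(log n - x) + G(-log n - x))` is continuous:
near any `x₀` it is the finite sum over `n ≤ e^{R + |x₀| + 1}`. [folklore] -/
theorem continuous_fakeSum_translate (hG : Continuous G) (hsupp : ∀ v : ℝ, R ≤ |v| → G v = 0)
    (c : ℕ → ℝ) :
    Continuous fun x : ℝ => ∑' n : ℕ, ((c n : ℝ) : ℂ) / (Real.sqrt n : ℂ) *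
      (G (Real.log n - x) + G (-Real.log n - x)) := by
  refine continuous_iff_continuousAt.2 fun x₀ => ?_
  set N : ℕ := ⌊Real.exp (R + (|x₀| + 1))⌋₊ + 1 with hN
  set F : ℝ → ℂ := fun x => ∑ n ∈ Finset.range N, ((c n : ℝ) : ℂ) / (Real.sqrt n : ℂ) *
    (G (Real.log n - x) + G (-Real.log n - x)) with hF
  have hFc : Continuous F := by
    simp only [hF]
    fun_prop
  have hev : (fun x : ℝ => ∑' n : ℕ, ((c n : ℝ) : ℂ) / (Real.sqrt n : ℂ) *
      (G (Real.log n - x) + G (-Real.log n - x))) =ᶠ[𝓝 x₀] F := by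
    refine eventuallyEq_of_mem (ball_mem_nhds x₀ one_pos) fun x hx => ?_
    refine tsum_eq_sum fun n hn => ?_
    rw [Finset.mem_range, not_lt] at hn
    have hx' : |x| ≤ |x₀| + 1 := by
      have h1 : |x - x₀| < 1 := by rwa [mem_ball, Real.dist_eq] at hx
      have := abs_add_le (x - x₀) x₀
      rw [sub_add_cancel] at this
      linarith
    obtain ⟨h1, h2⟩ := shift_eq_zero_of_le_log hsupp (le_log_of_floor_lt hx' hn)
    rw [h1, h2, add_zero, mul_zero]
  exact (hFc.continuousAt.congr hev.symm)

/-! ## Integrability of the terms and the summable majorant -/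

/-- The shifted kernel `x ↦ G(b - x)` is continuous with compact support. [folklore] -/
theorem hasCompactSupport_shift (hG : Continuous G) (hsupp : ∀ v : ℝ, R ≤ |v| → G v = 0) (b : ℝ) :
    Continuous (fun x : ℝ => G (b - x)) ∧ HasCompactSupport fun x : ℝ => G (b - x) := by
  refine ⟨hG.comp (continuous_const.sub continuous_id), ?_⟩
  refine HasCompactSupport.of_support_subset_isCompact (isCompact_Icc (a := b - R) (b := b + R))
    fun x hx => ?_
  by_contra hxI
  simp only [mem_Icc, not_and_or, not_le] at hxI
  refine hx (hsupp _ ?_)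
  rcases hxI with h | h
  · exact le_trans (by linarith) (le_abs_self _)
  · exact le_trans (by linarith) (neg_le_abs _)

/-- Each term `(G(log n - x) + G(-log n - x)) e^{-zx}` is integrable on `(0, ∞)`. [folklore] -/
theorem integrableOn_shift_term (hG : Continuous G) (hsupp : ∀ v : ℝ, R ≤ |v| → G v = 0) (n : ℕ)
    (z : ℂ) :
    IntegrableOn (fun x : ℝ => (G (Real.log n - x) + G (-Real.log n - x)) * cexp (-(z * x))) (Ioi 0) := by
  obtain ⟨hc1, hs1⟩ := hasCompactSupport_shift hG hsupp (Real.log n)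
  obtain ⟨hc2, hs2⟩ := hasCompactSupport_shift hG hsupp (-Real.log n)
  have hc : Continuous fun x : ℝ => (G (Real.log n - x) + G (-Real.log n - x)) * cexp (-(z * x)) :=
    (hc1.add hc2).mul (by fun_prop)
  exact (hc.integrable_of_hasCompactSupport ((hs1.add hs2).mul_right)).integrableOn

/-- The norm of the `n`-th Laplace integrand is bounded in `L¹(0, ∞)` by
`2RM (e^{σ(R - log n)} + [log n < R] e^{2σR})`, `σ = Re z ≥ 0`. [folklore] -/
theorem integral_norm_shift_term_le (hG : Continuous G) (hsupp : ∀ v : ℝ, R ≤ |v| → G v = 0)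
    (hR : 0 ≤ R) {M : ℝ} (hM : ∀ v, ‖G v‖ ≤ M) {z : ℂ} (hz : 0 ≤ z.re) (n : ℕ) :
    ∫ x in Ioi (0 : ℝ), ‖(G (Real.log n - x) + G (-Real.log n - x)) * cexp (-(z * x))‖ ≤
      2 * R * M * Real.exp (z.re * (R - Real.log n)) +
        (if Real.log n < R then 2 * R * M * Real.exp (z.re * (2 * R)) else 0) := by
  have hM0 : 0 ≤ M := (norm_nonneg _).trans (hM 0)
  obtain ⟨hc1, hs1⟩ := hasCompactSupport_shift hG hsupp (Real.log n)
  obtain ⟨hc2, hs2⟩ := hasCompactSupport_shift hG hsupp (-Real.log n)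
  have hexp : ∀ x : ℝ, ‖cexp (-(z * x))‖ = Real.exp (-(z.re * x)) := fun x => by
    rw [Complex.norm_exp]
    simp [mul_re]
  -- split the norm
  have hI1 : Integrable (fun x : ℝ => ‖G (Real.log n - x)‖ * Real.exp (-(z.re * x)))
      (volume.restrict (Ioi 0)) :=
    ((hc1.norm.mul (by fun_prop)).integrable_of_hasCompactSupport hs1.norm.mul_right).integrableOn
  have hI2 : Integrable (fun x : ℝ => ‖G (-Real.log n - x)‖ * Real.exp (-(z.re * x)))
      (volume.restrict (Ioi 0)) :=
    ((hc2.norm.mul (by fun_prop)).integrable_of_hasCompactSupport hs2.norm.mul_right).integrableOn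
  have hle : ∀ x : ℝ, ‖(G (Real.log n - x) + G (-Real.log n - x)) * cexp (-(z * x))‖ ≤
      ‖G (Real.log n - x)‖ * Real.exp (-(z.re * x)) + ‖G (-Real.log n - x)‖ * Real.exp (-(z.re * x)) := by
    intro x
    rw [norm_mul, hexp, ← add_mul]
    exact mul_le_mul_of_nonneg_right (norm_add_le _ _) (Real.exp_pos _).le
  have h1 := integral_norm_shift_mul_exp_le hsupp hR hM hz (Real.log n)
  have h2 : ∫ x in Ioi (0 : ℝ), ‖G (-Real.log n - x)‖ * Real.exp (-(z.re * x)) ≤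
      (if Real.log n < R then 2 * R * M * Real.exp (z.re * (2 * R)) else 0) := by
    split_ifs with hlt
    · have h := integral_norm_shift_mul_exp_le hsupp hR hM hz (-Real.log n)
      refine h.trans (mul_le_mul_of_nonneg_left (Real.exp_le_exp.2 ?_) (by positivity))
      have : R - -Real.log n ≤ 2 * R := by linarith
      exact mul_le_mul_of_nonneg_left this hz
    · rw [not_lt] at hlt
      refine le_of_eq (setIntegral_eq_zero_of_forall_eq_zero fun x hx => ?_)
      have hx' : 0 < x := hx
      have h0 : G (-Real.log n - x) = 0 := by
        apply hsupp
        rw [show -Real.log n - x = -(Real.log n + x) by ring, abs_neg, abs_of_nonneg (by linarith [Real.log_natCast_nonneg n])]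
        linarith
      rw [h0, norm_zero, zero_mul]
  calc ∫ x in Ioi (0 : ℝ), ‖(G (Real.log n - x) + G (-Real.log n - x)) * cexp (-(z * x))‖
      ≤ ∫ x in Ioi (0 : ℝ), (‖G (Real.log n - x)‖ * Real.exp (-(z.re * x)) +
          ‖G (-Real.log n - x)‖ * Real.exp (-(z.re * x))) :=
        setIntegral_mono_on ((integrableOn_shift_term hG hsupp n z).norm) (hI1.add hI2)
          measurableSet_Ioi fun x _ => hle x
    _ = (∫ x in Ioi (0 : ℝ), ‖G (Real.log n - x)‖ * Real.exp (-(z.re * x))) +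
          ∫ x in Ioi (0 : ℝ), ‖G (-Real.log n - x)‖ * Real.exp (-(z.re * x)) := integral_add hI1 hI2
    _ ≤ _ := add_le_add h1 h2

/-! ## Termwise Laplace transform -/

/-- The LSeries weights `c(n) n^{-1/2}` as complex numbers: `‖c(n)/√n‖ = c(n) n^{-1/2}` for `c ≥ 0`.
[folklore] -/
theorem norm_coeff_div_sqrt (hc : ∀ n, 0 ≤ c n) (n : ℕ) :
    ‖((c n : ℝ) : ℂ) / (Real.sqrt n : ℂ)‖ = c n / Real.sqrt n := by
  rw [norm_div, Complex.norm_real, Complex.norm_real, Real.norm_of_nonneg (hc n),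
    Real.norm_of_nonneg (Real.sqrt_nonneg _)]

/-- `e^{σ(R - log n)} = e^{σR} n^{-σ}` and the comparison with the LSeries term: for `n ≥ 1`, `σ ≥ 0`,
`(c(n)/√n) · 2RM e^{σ(R - log n)} = 2RM e^{σR} · ‖term c (σ + 1/2) n‖`. [folklore] -/
theorem coeff_mul_exp_eq_term (hc : ∀ n, 0 ≤ c n) {σ : ℝ} {n : ℕ} (hn : n ≠ 0) (A : ℝ) :
    c n / Real.sqrt n * (A * Real.exp (σ * (R - Real.log n))) =
      A * Real.exp (σ * R) * ‖LSeries.term (fun n => ((c n : ℝ) : ℂ)) ((σ + 1 / 2 : ℝ) : ℂ) n‖ := by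
  have hn0 : (0 : ℝ) < n := by exact_mod_cast Nat.pos_of_ne_zero hn
  rw [LSeries.norm_term_eq, if_neg hn, Complex.norm_real, Real.norm_of_nonneg (hc n), ofReal_re,
    mul_sub, Real.exp_sub, Real.rpow_add hn0, Real.sqrt_eq_rpow,
    show Real.exp (σ * Real.log n) = (n : ℝ) ^ σ by rw [Real.rpow_def_of_pos hn0, mul_comm]]
  have h1 : (0 : ℝ) < (n : ℝ) ^ σ := Real.rpow_pos_of_pos hn0 σ
  have h2 : (0 : ℝ) < (n : ℝ) ^ (1 / 2 : ℝ) := Real.rpow_pos_of_pos hn0 _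
  field_simp

/-- **Termwise Laplace transform of the translated fake prime sum.** For `c ≥ 0`, `Re z ≥ 0` and
`Σ c(n) n^{-(Re z + 1/2)} < ∞`:
`∫₀^∞ (Σₙ c(n) n^{-1/2}(G(log n - x) + G(-log n - x))) e^{-zx} dx
   = Σₙ c(n) n^{-1/2} ∫₀^∞ (G(log n - x) + G(-log n - x)) e^{-zx} dx`. [folklore] -/
theorem integral_fakeSum_translate_mul_exp (hG : Continuous G) (hsupp : ∀ v : ℝ, R ≤ |v| → G v = 0)
    (hR : 0 ≤ R) {M : ℝ} (hM : ∀ v, ‖G v‖ ≤ M) (hc : ∀ n, 0 ≤ c n) {z : ℂ} (hz : 0 ≤ z.re)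
    (hsum : LSeriesSummable (fun n => ((c n : ℝ) : ℂ)) ((z.re + 1 / 2 : ℝ) : ℂ)) :
    ∫ x in Ioi (0 : ℝ), (∑' n : ℕ, ((c n : ℝ) : ℂ) / (Real.sqrt n : ℂ) *
        (G (Real.log n - x) + G (-Real.log n - x))) * cexp (-(z * x)) =
      ∑' n : ℕ, ((c n : ℝ) : ℂ) / (Real.sqrt n : ℂ) *
        ∫ x in Ioi (0 : ℝ), (G (Real.log n - x) + G (-Real.log n - x)) * cexp (-(z * x)) := by
  have hM0 : 0 ≤ M := (norm_nonneg _).trans (hM 0)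
  set F : ℕ → ℝ → ℂ := fun n x => ((c n : ℝ) : ℂ) / (Real.sqrt n : ℂ) *
    ((G (Real.log n - x) + G (-Real.log n - x)) * cexp (-(z * x))) with hF
  have hFi : ∀ n, Integrable (F n) (volume.restrict (Ioi 0)) := fun n =>
    (integrableOn_shift_term hG hsupp n z).const_mul _
  -- the summable majorant
  set N₀ : ℕ := ⌊Real.exp R⌋₊ + 1 with hN₀
  set bnd : ℕ → ℝ := fun n => 2 * R * M * Real.exp (z.re * R) *
      ‖LSeries.term (fun n => ((c n : ℝ) : ℂ)) ((z.re + 1 / 2 : ℝ) : ℂ) n‖ +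
    (if n < N₀ then c n / Real.sqrt n * (2 * R * M * Real.exp (z.re * (2 * R))) else 0) with hbnd
  have hbnd_sum : Summable bnd := by
    refine (hsum.norm.mul_left _).add ?_
    refine summable_of_ne_finset_zero (s := Finset.range N₀) fun n hn => ?_
    rw [Finset.mem_range] at hn
    simp only [if_neg hn]
  have hle : ∀ n, ∫ x in Ioi (0 : ℝ), ‖F n x‖ ≤ bnd n := by
    intro n
    have e : ∀ x, ‖F n x‖ = c n / Real.sqrt n *
        ‖(G (Real.log n - x) + G (-Real.log n - x)) * cexp (-(z * x))‖ := fun x => by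
      simp only [hF, norm_mul, norm_coeff_div_sqrt hc]
    simp_rw [e]
    rw [integral_const_mul]
    have h := integral_norm_shift_term_le hG hsupp hR hM hz n
    have hcoef : 0 ≤ c n / Real.sqrt n := div_nonneg (hc n) (Real.sqrt_nonneg _)
    refine (mul_le_mul_of_nonneg_left h hcoef).trans ?_
    rw [mul_add]
    refine add_le_add ?_ ?_
    · rcases eq_or_ne n 0 with rfl | hn
      · simp
      · rw [coeff_mul_exp_eq_term hc hn]
    · by_cases hlt : Real.log n < R
      · have hnN : n < N₀ := by
          by_contra hge
          rw [not_lt] at hge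
          have := le_log_of_floor_lt (X := 0) (x := 0) (R := R) (by simp) (by simpa [hN₀] using hge)
          simp at this
          linarith
        rw [if_pos hlt, if_pos hnN]
      · rw [if_neg hlt, mul_zero]
        split_ifs <;> positivity
  have hsumm : Summable fun n => ∫ x in Ioi (0 : ℝ), ‖F n x‖ :=
    Summable.of_nonneg_of_le (fun n => integral_nonneg fun x => norm_nonneg _) hle hbnd_sum
  have key := integral_tsum_of_summable_integral_norm hFi hsumm
  have e1 : (fun x : ℝ => (∑' n : ℕ, ((c n : ℝ) : ℂ) / (Real.sqrt n : ℂ) *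
      (G (Real.log n - x) + G (-Real.log n - x))) * cexp (-(z * x))) = fun x => ∑' n, F n x := by
    funext x
    rw [← tsum_mul_right]
    refine tsum_congr fun n => ?_
    simp only [hF]
    ring
  rw [e1, ← key]
  refine tsum_congr fun n => ?_
  simp only [hF]
  exact integral_const_mul _ _

/-! ## The identity `D_c(z + 1/2) Gt(z) = 𝓛P(z) - Fin(z)` -/

/-- The `n`-th term evaluated for `log n ≥ R`: `n^{-z} Gt(z)`; its LSeries form for `n ≥ 1`:
`(c(n)/√n) n^{-z} = term c (z + 1/2) n`. [folklore] -/
theorem coeff_mul_cpow_eq_term (c : ℕ → ℝ) {n : ℕ} (hn : n ≠ 0) (z : ℂ) :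
    ((c n : ℝ) : ℂ) / (Real.sqrt n : ℂ) * cexp (-(z * Real.log n)) =
      LSeries.term (fun n => ((c n : ℝ) : ℂ)) (z + 1 / 2) n := by
  have hn0 : (0 : ℝ) < n := by exact_mod_cast Nat.pos_of_ne_zero hn
  have hnC : (n : ℂ) ≠ 0 := by exact_mod_cast hn
  rw [LSeries.term_of_ne_zero hn]
  have hsq : ((Real.sqrt n : ℝ) : ℂ) = cexp ((Real.log n : ℂ) * (1 / 2)) := by
    rw [Real.sqrt_eq_rpow, Real.rpow_def_of_pos hn0, Complex.ofReal_exp]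
    push_cast
    ring_nf
  have hpow : (n : ℂ) ^ (z + 1 / 2) = (Real.sqrt n : ℂ) * cexp (z * Real.log n) := by
    rw [Complex.cpow_def_of_ne_zero hnC, ← Complex.natCast_log, hsq, ← Complex.exp_add]
    congr 1
    ring
  rw [hpow, Complex.exp_neg, ← div_eq_mul_inv, div_div]

/-- **The identity.** For `c ≥ 0`, `Re z ≥ 0`, `Σ c(n) n^{-(Re z + 1/2)} < ∞`, and `N₀ = ⌊e^R⌋ + 1`:
`D_c(z + 1/2) · Gt(z) = ∫₀^∞ P(x) e^{-zx} dx - Fin(z)` with `Gt(z) = ∫ G(v) e^{zv} dv`,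
`P(x) = Σₙ c(n) n^{-1/2}(G(log n - x) + G(-log n - x))` and the FINITE correction
`Fin(z) = Σ_{n < N₀} c(n) n^{-1/2} (∫₀^∞ (G(log n - x) + G(-log n - x)) e^{-zx} dx - e^{-z log n} Gt(z))`.
[folklore] -/
theorem LSeries_mul_transform_eq (hG : Continuous G) (hsupp : ∀ v : ℝ, R ≤ |v| → G v = 0)
    (hR : 0 ≤ R) {M : ℝ} (hM : ∀ v, ‖G v‖ ≤ M) (hc : ∀ n, 0 ≤ c n) {z : ℂ} (hz : 0 ≤ z.re)
    (hsum : LSeriesSummable (fun n => ((c n : ℝ) : ℂ)) ((z.re + 1 / 2 : ℝ) : ℂ)) :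
    LSeries (fun n => ((c n : ℝ) : ℂ)) (z + 1 / 2) * ∫ v : ℝ, G v * cexp (z * v) =
      (∫ x in Ioi (0 : ℝ), (∑' n : ℕ, ((c n : ℝ) : ℂ) / (Real.sqrt n : ℂ) *
        (G (Real.log n - x) + G (-Real.log n - x))) * cexp (-(z * x))) -
      ∑ n ∈ Finset.range (⌊Real.exp R⌋₊ + 1), ((c n : ℝ) : ℂ) / (Real.sqrt n : ℂ) *
        ((∫ x in Ioi (0 : ℝ), (G (Real.log n - x) + G (-Real.log n - x)) * cexp (-(z * x))) -
          cexp (-(z * Real.log n)) * ∫ v : ℝ, G v * cexp (z * v)) := by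
  set N₀ : ℕ := ⌊Real.exp R⌋₊ + 1 with hN₀
  set Gt : ℂ := ∫ v : ℝ, G v * cexp (z * v) with hGt
  set J : ℕ → ℂ := fun n => ∫ x in Ioi (0 : ℝ), (G (Real.log n - x) + G (-Real.log n - x)) *
    cexp (-(z * x)) with hJ
  rw [integral_fakeSum_translate_mul_exp hG hsupp hR hM hc hz hsum]
  -- `J n = n^{-z} Gt` for `n ≥ N₀`
  have hJ_eq : ∀ n : ℕ, N₀ ≤ n → J n = cexp (-(z * Real.log n)) * Gt := by
    intro n hn
    have hlog : R ≤ Real.log n := by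
      have := le_log_of_floor_lt (X := 0) (x := 0) (R := R) (by simp) (by simpa [hN₀] using hn)
      simpa using this
    simp only [hJ]
    have hsplit : (fun x : ℝ => (G (Real.log n - x) + G (-Real.log n - x)) * cexp (-(z * x))) =
        fun x : ℝ => G (Real.log n - x) * cexp (-(z * x)) + G (-Real.log n - x) * cexp (-(z * x)) := by
      funext x; ring
    obtain ⟨hc1, hs1⟩ := hasCompactSupport_shift hG hsupp (Real.log n)
    obtain ⟨hc2, hs2⟩ := hasCompactSupport_shift hG hsupp (-Real.log n)
    have hi1 : IntegrableOn (fun x : ℝ => G (Real.log n - x) * cexp (-(z * x))) (Ioi 0) :=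
      ((hc1.mul (by fun_prop)).integrable_of_hasCompactSupport hs1.mul_right).integrableOn
    have hi2 : IntegrableOn (fun x : ℝ => G (-Real.log n - x) * cexp (-(z * x))) (Ioi 0) :=
      ((hc2.mul (by fun_prop)).integrable_of_hasCompactSupport hs2.mul_right).integrableOn
    rw [hsplit, integral_add hi1 hi2, laplace_shift_eq hsupp hR hlog z,
      laplace_shift_neg_eq_zero hsupp hR hlog z, add_zero]
  -- the LSeries as a `tsum` of the evaluated terms
  have hS : LSeriesSummable (fun n => ((c n : ℝ) : ℂ)) (z + 1 / 2) :=
    hsum.of_re_le_re (by simp)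
  have hterm : ∀ n, ((c n : ℝ) : ℂ) / (Real.sqrt n : ℂ) * (cexp (-(z * Real.log n)) * Gt) =
      LSeries.term (fun n => ((c n : ℝ) : ℂ)) (z + 1 / 2) n * Gt := by
    intro n
    rcases eq_or_ne n 0 with rfl | hn
    · simp
    · rw [← mul_assoc, coeff_mul_cpow_eq_term c hn z]
  have hL : LSeries (fun n => ((c n : ℝ) : ℂ)) (z + 1 / 2) * Gt =
      ∑' n : ℕ, ((c n : ℝ) : ℂ) / (Real.sqrt n : ℂ) * (cexp (-(z * Real.log n)) * Gt) := by
    simp_rw [hterm]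
    rw [LSeries, tsum_mul_right]
  -- split the termwise sum into the evaluated part and the finite correction
  have hcorr : ∀ n ∉ Finset.range N₀, ((c n : ℝ) : ℂ) / (Real.sqrt n : ℂ) *
      (J n - cexp (-(z * Real.log n)) * Gt) = 0 := by
    intro n hn
    rw [Finset.mem_range, not_lt] at hn
    rw [hJ_eq n hn, sub_self, mul_zero]
  have hsumE : Summable fun n : ℕ => ((c n : ℝ) : ℂ) / (Real.sqrt n : ℂ) * (cexp (-(z * Real.log n)) * Gt) := by
    simp_rw [hterm]
    exact hS.mul_right Gt
  have hsumC : Summable fun n : ℕ => ((c n : ℝ) : ℂ) / (Real.sqrt n : ℂ) *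
      (J n - cexp (-(z * Real.log n)) * Gt) := summable_of_ne_finset_zero hcorr
  have hdecomp : (fun n : ℕ => ((c n : ℝ) : ℂ) / (Real.sqrt n : ℂ) * J n) =
      fun n => ((c n : ℝ) : ℂ) / (Real.sqrt n : ℂ) * (cexp (-(z * Real.log n)) * Gt) +
        ((c n : ℝ) : ℂ) / (Real.sqrt n : ℂ) * (J n - cexp (-(z * Real.log n)) * Gt) := by
    funext n; ring
  show LSeries (fun n => ((c n : ℝ) : ℂ)) (z + 1 / 2) * Gt =
    (∑' n : ℕ, ((c n : ℝ) : ℂ) / (Real.sqrt n : ℂ) * J n) -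
      ∑ n ∈ Finset.range N₀, ((c n : ℝ) : ℂ) / (Real.sqrt n : ℂ) * (J n - cexp (-(z * Real.log n)) * Gt)
  rw [hdecomp, hsumE.tsum_add hsumC, tsum_eq_sum hcorr, hL]
  ring

/-! ## Holomorphy of the finite correction -/

/-- Each correction term `z ↦ c(n) n^{-1/2} (J_n(z) - e^{-z log n} Gt(z))` is holomorphic on `Re z > 0`:
`J_n` is the Laplace transform of the bounded continuous `x ↦ G(log n - x) + G(-log n - x)`
(`differentiableOn_laplace`), and `Gt(z) = ∫ G(v) e^{zv} dv` is supplied holomorphic. [folklore] -/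
theorem differentiableOn_finCorrection (hG : Continuous G) (hsupp : ∀ v : ℝ, R ≤ |v| → G v = 0)
    {M : ℝ} (hM : ∀ v, ‖G v‖ ≤ M) (c : ℕ → ℝ) (N : ℕ)
    (hGt : DifferentiableOn ℂ (fun z : ℂ => ∫ v : ℝ, G v * cexp (z * v)) {z : ℂ | 0 < z.re}) :
    DifferentiableOn ℂ (fun z : ℂ => ∑ n ∈ Finset.range N, ((c n : ℝ) : ℂ) / (Real.sqrt n : ℂ) *
        ((∫ x in Ioi (0 : ℝ), (G (Real.log n - x) + G (-Real.log n - x)) * cexp (-(z * x))) -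
          cexp (-(z * Real.log n)) * ∫ v : ℝ, G v * cexp (z * v))) {z : ℂ | 0 < z.re} := by
  refine DifferentiableOn.fun_sum fun n _ => DifferentiableOn.const_mul ?_ _
  refine DifferentiableOn.sub ?_ (DifferentiableOn.mul (by fun_prop) hGt)
  obtain ⟨hc1, _⟩ := hasCompactSupport_shift hG hsupp (Real.log n)
  obtain ⟨hc2, _⟩ := hasCompactSupport_shift hG hsupp (-Real.log n)
  have hM0 : 0 ≤ M := (norm_nonneg _).trans (hM 0)
  exact differentiableOn_laplace (hc1.add hc2) (C := M + M) fun x _ =>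
    (norm_add_le _ _).trans (add_le_add (hM _) (hM _))

end Summit.RiemannHypothesis.RiemannHypothesis.Theorems.SignCone

end
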